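import Mathlib.FieldTheory.IntermediateField.Basic
import Mathlib.Analysis.Complex.Polynomial.Basic
import Mathlib.LinearAlgebra.Matrix.Rank
import Literature.NumberTheory.Transcendental.RosenlichtProp4Residues
import Literature.NumberTheory.Transcendental.ExpVarietiesDimension
import HarnessLib

/-!
# Weak CIT, step 1: the Schanuel bound in a single differential field

Support file for the discharge of the named fact `Literature.NumberTheory.Transcendental.weakCIT`
(`IntersectionsWithTori.lean`; Zilber 2002, Corollary 3 = Aslanyan 2024, Thm 2.13 = Kirby 2009,
Thm 4.6). The proof of weak CIT in Zilber 2002 / Kirby 2009 has two ingredients: Ax's theorem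
(Ax 1971, Thm 3 — the tree's `Literature.NumberTheory.Transcendental.ax_schanuel_of_field`, proved
in `AxSchanuelProofs.lean` / `RosenlichtProp4Residues.lean`) and the compactness theorem, which
makes Ax's theorem *uniform* (Kirby 2009, Thm 4.3 "uniform Schanuel property"). This file isolates
the purely algebraic consequence of Ax's theorem that the compactness step (done with an explicit
ultraproduct in `WeakCITUltraproduct.lean`) feeds on.

**The statement** (`exists_int_relation`). Let `F ⊇ ℂ` be a field of characteristic zero with
derivations `D₁, …, Dₙ` killing `ℂ`, constants `C`, and `x, y, x' ∈ Fⁿ` with `yᵢ ≠ 0`,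
`Dⱼ yᵢ = yᵢ Dⱼ xᵢ` ("`y = exp x`"), `x' = U x`, `x = U' x'` for matrices `U, U'` with constant
entries, `x'ⱼ ∈ C` for `j ∈ J`, `Dⱼ xᵢ = δᵢⱼ` for `i ∈ S`, and `y` a zero of a prime ideal
`I ⊆ ℂ[Y₁, …, Yₙ]` with `dim Z(I) ≤ d < |S| + |J|`. Then some non-trivial integer combination
`Σ qᵢ xᵢ` is a constant. Indeed otherwise Ax's theorem gives
`n + |S| ≤ n + rank (Dⱼ xᵢ) ≤ trdeg_C C[x, y]`, while `C[x, y] = C[x', y]` has a transcendence basis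
inside `{x'ⱼ : j ∉ J} ∪ {yᵢ}` whose `y`-part is `ℂ`-algebraically independent, so that
`trdeg_C C[x, y] ≤ (n - |J|) + trdeg_ℂ ℂ[y] ≤ (n - |J|) + d` (Kirby 2009, proof of Thm 4.6:
"`dim V_{Ma,p} - rk Jac(x,y) = dim κ + dim U_p - dim X`").

## References

* B. Zilber, *Exponential sums equations and the Schanuel conjecture*, J. London Math. Soc. (2) 65
  (2002) 27–44, Corollary 3.
* J. Kirby, *The theory of the exponential differential equations of semiabelian varieties*,
  Selecta Math. 15 (2009) 445–486 (arXiv:0708.1352), Thm 4.3 and Thm 4.6.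
* J. Ax, *On Schanuel's conjectures*, Ann. of Math. 93 (1971) 252–268, Thm 3.
-/

noncomputable section

open MvPolynomial Set Cardinal

namespace Literature.NumberTheory.Transcendental.WeakCIT

variable {F : Type} [Field F] [Algebra ℂ F] {n : ℕ}

/-- The field of common constants `C = ⋂ⱼ ker Dⱼ` of derivations `Dⱼ` of `F` killing `ℂ`, as an
intermediate field of `F/ℂ` (kernels of derivations of a field are subfields). [folklore] -/
def constField (D : Fin n → Derivation ℤ F F) (hD : ∀ j (c : ℂ), D j (algebraMap ℂ F c) = 0) :
    IntermediateField ℂ F where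
  carrier := {a | ∀ j, D j a = 0}
  mul_mem' {a b} ha hb := fun j => by simp [Derivation.leibniz, ha j, hb j]
  one_mem' := fun j => Derivation.map_one_eq_zero _
  add_mem' {a b} ha hb := fun j => by simp [map_add, ha j, hb j]
  zero_mem' := fun j => map_zero _
  algebraMap_mem' c := fun j => hD j c
  inv_mem' a ha := fun j => by
    rcases eq_or_ne a 0 with rfl | ha0
    · simp
    · have h : D j (a * a⁻¹) = 0 := by rw [mul_inv_cancel₀ ha0]; exact Derivation.map_one_eq_zero _
      rw [Derivation.leibniz, ha j, smul_zero, add_zero, smul_eq_mul] at h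
      exact (mul_eq_zero.1 h).resolve_left ha0

/-- Membership in the constant field: all derivations vanish. [folklore] -/
theorem mem_constField_iff {D : Fin n → Derivation ℤ F F}
    {hD : ∀ j (c : ℂ), D j (algebraMap ℂ F c) = 0} {a : F} :
    a ∈ constField D hD ↔ ∀ j, D j a = 0 :=
  Iff.rfl

/-- A derivation is linear over its constants: `Dⱼ` as a `C`-derivation. [folklore] -/
def constDerivation (D : Fin n → Derivation ℤ F F) (hD : ∀ j (c : ℂ), D j (algebraMap ℂ F c) = 0)
    (j : Fin n) : Derivation (constField D hD) F F where
  toFun := D j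
  map_add' := map_add (D j)
  map_smul' r a := by
    show D j ((r : F) * a) = (r : F) * D j a
    rw [Derivation.leibniz, r.2 j, smul_zero, add_zero, smul_eq_mul]
  map_one_eq_zero' := (D j).map_one_eq_zero
  leibniz' a b := (D j).leibniz a b

/-- Unfolding `constDerivation`. [folklore] -/
@[simp] theorem constDerivation_apply (D : Fin n → Derivation ℤ F F)
    (hD : ∀ j (c : ℂ), D j (algebraMap ℂ F c) = 0) (j : Fin n) (a : F) :
    constDerivation D hD j a = D j a :=
  rfl

/-- If `y ∈ Fⁿ` is a zero of an ideal `I ⊆ ℂ[Y]` with `dim Z(I) ≤ d`, then `trdeg_ℂ ℂ[y] ≤ d`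
(`ℂ[y] ≅ ℂ[Y]/ker`, `ker ⊇ I`, and dimension = transcendence degree for affine domains).
[cite: Matsumura1987, Thm 5.6] -/
theorem trdeg_range_aeval_le (y : Fin n → F) (I : Ideal (MvPolynomial (Fin n) ℂ))
    (hI : ∀ p ∈ I, aeval y p = 0) {d : ℕ} (hd : zariskiDim ℂ (zeroLocus ℂ I) ≤ d) :
    Algebra.trdeg ℂ (aeval y : MvPolynomial (Fin n) ℂ →ₐ[ℂ] F).range ≤ (d : Cardinal) := by
  set φ := (aeval y : MvPolynomial (Fin n) ℂ →ₐ[ℂ] F) with hφ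
  haveI : Algebra.FiniteType ℂ φ.range :=
    Algebra.FiniteType.of_surjective φ.rangeRestrict (AlgHom.rangeRestrict_surjective φ)
  have hker : I ≤ RingHom.ker φ := fun p hp => by
    rw [RingHom.mem_ker]
    exact hI p hp
  have h1 : zariskiDim ℂ (zeroLocus ℂ (RingHom.ker φ)) ≤ d :=
    (zariskiDim_mono (zeroLocus_anti_mono hker)).trans hd
  rw [zariskiDim_zeroLocus_ker φ] at h1
  have hfin : Algebra.trdeg ℂ φ.range = Cardinal.toNat (Algebra.trdeg ℂ φ.range) :=
    Literature.RingTheory.KrullDimension.trdeg_eq_toNat ℂ φ.range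
  rw [hfin]
  exact_mod_cast (WithBot.coe_le_coe.mp h1 : (Cardinal.toNat (Algebra.trdeg ℂ φ.range) : ℕ∞) ≤ d)

/-- **The Schanuel bound in one differential field** (the algebraic core of Kirby 2009, Thm 4.6,
from Ax's theorem `ax_schanuel_of_field`). With the notation of the module docstring: if
`dim Z(I) ≤ d < |S| + |J|` then some non-trivial integer combination `Σ qᵢ xᵢ` is killed by
every `Dⱼ`. [cite: Kirby2009, Thm 4.6 (proof)] -/
theorem exists_int_relation [CharZero F] (D : Fin n → Derivation ℤ F F)
    (hD : ∀ j (c : ℂ), D j (algebraMap ℂ F c) = 0)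
    (x y x' : Fin n → F) (U U' : Matrix (Fin n) (Fin n) F)
    (hU : ∀ j i l, D j (U i l) = 0) (hU' : ∀ j i l, D j (U' i l) = 0)
    (hx' : ∀ i, x' i = ∑ l, U i l * x l) (hx : ∀ i, x i = ∑ l, U' i l * x' l)
    (J : Finset (Fin n)) (hJ : ∀ i ∈ J, ∀ j, D j (x' i) = 0)
    (S : Finset (Fin n)) (hS : ∀ i ∈ S, ∀ j, D j (x i) = if i = j then 1 else 0)
    (hy : ∀ i, y i ≠ 0) (hexp : ∀ j i, D j (y i) = y i * D j (x i))
    (I : Ideal (MvPolynomial (Fin n) ℂ)) (hI : ∀ p ∈ I, aeval y p = 0)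
    {d : ℕ} (hd : zariskiDim ℂ (zeroLocus ℂ I) ≤ d) (hlt : d < S.card + J.card) :
    ∃ q : Fin n → ℤ, q ≠ 0 ∧ ∀ j, D j (∑ i, (q i : F) * x i) = 0 := by
  classical
  by_contra hcon
  push Not at hcon
  -- the field of constants and the derivations over it
  set K₀ : IntermediateField ℂ F := constField D hD with hK₀
  haveI : CharZero K₀ := (algebraMap K₀ F).charZero
  let Dk : Fin n → Derivation K₀ F F := constDerivation D hD
  have hC : ∀ a : F, (∀ j, Dk j a = 0) → a ∈ Set.range (algebraMap K₀ F) :=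
    fun a ha => ⟨⟨a, fun j => ha j⟩, rfl⟩
  have hind : ∀ q : Fin n → ℤ, (∀ j, Dk j (∑ i, (q i : F) * x i) = 0) → q = 0 := by
    intro q hq
    by_contra hq0
    obtain ⟨j, hj⟩ := hcon q hq0
    exact hj (hq j)
  have hAS := ax_schanuel_of_field Rosenlicht.Rosenlicht1976_prop4_holds Dk hC x y hy
    (fun j i => hexp j i) hind
  -- (1) the rank term is at least `|S|`: the rows `i ∈ S` of `(Dⱼ xᵢ)` are the unit vectors
  set M : Matrix (Fin n) (Fin n) F := Matrix.of fun i j => Dk j (x i) with hM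
  have hrank : S.card ≤ M.rank := by
    rw [Matrix.rank_eq_finrank_span_row]
    have hrow : ∀ i ∈ S, M i = Pi.single i (1 : F) := by
      intro i hi
      funext j
      rw [hM, Matrix.of_apply, constDerivation_apply, hS i hi j, Pi.single_apply]
      simp only [eq_comm]
    have hli : LinearIndependent F (fun i : S => (Pi.single (i : Fin n) (1 : F) : Fin n → F)) := by
      have := (Pi.basisFun F (Fin n)).linearIndependent
      have h2 : (fun i : S => (Pi.single (i : Fin n) (1 : F) : Fin n → F)) =
          (Pi.basisFun F (Fin n)) ∘ ((↑) : S → Fin n) := by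
        funext i
        simp [Pi.basisFun_apply]
      rw [h2]
      exact this.comp _ Subtype.val_injective
    have hsub : Set.range (fun i : S => (Pi.single (i : Fin n) (1 : F) : Fin n → F)) ⊆ Set.range M := by
      rintro _ ⟨i, rfl⟩
      exact ⟨i, hrow i i.2⟩
    calc S.card = Fintype.card S := (Fintype.card_coe S).symm
      _ = Module.finrank F (Submodule.span F
            (Set.range (fun i : S => (Pi.single (i : Fin n) (1 : F) : Fin n → F)))) :=
          (finrank_span_eq_card hli).symm
      _ ≤ Module.finrank F (Submodule.span F (Set.range M)) :=
          Submodule.finrank_mono (Submodule.span_mono hsub)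
  -- (2) `C[x, y] = C[x', y]`
  set A : Subalgebra K₀ F := Algebra.adjoin K₀ (Set.range x ∪ Set.range y) with hA
  set B : Subalgebra K₀ F := Algebra.adjoin K₀ (Set.range x' ∪ Set.range y) with hB
  have hmemK : ∀ (u : F), (∀ j, D j u = 0) → ∀ (T : Subalgebra K₀ F), u ∈ T := fun u hu T => by
    have := T.algebraMap_mem (⟨u, hu⟩ : K₀)
    exact this
  have hAB : A = B := by
    apply le_antisymm
    · rw [hA, Algebra.adjoin_le_iff]
      rintro a (⟨i, rfl⟩ | ⟨i, rfl⟩)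
      · rw [hx i]
        refine Subalgebra.sum_mem _ fun l _ => Subalgebra.mul_mem _ (hmemK _ (fun j => hU' j i l) _)
          (Algebra.subset_adjoin (Or.inl ⟨l, rfl⟩))
      · exact Algebra.subset_adjoin (Or.inr ⟨i, rfl⟩)
    · rw [hB, Algebra.adjoin_le_iff]
      rintro a (⟨i, rfl⟩ | ⟨i, rfl⟩)
      · rw [hx' i]
        refine Subalgebra.sum_mem _ fun l _ => Subalgebra.mul_mem _ (hmemK _ (fun j => hU j i l) _)
          (Algebra.subset_adjoin (Or.inl ⟨l, rfl⟩))
      · exact Algebra.subset_adjoin (Or.inr ⟨i, rfl⟩)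
  -- (3) a transcendence basis of `B` over `C` inside the generators
  set G : Set B := ((↑) : B → F) ⁻¹' (Set.range x' ∪ Set.range y) with hG
  have hGtop : Algebra.adjoin K₀ G = ⊤ := by
    apply Subalgebra.map_injective (f := B.val) Subtype.val_injective
    rw [AlgHom.map_adjoin, Algebra.map_top, Subalgebra.range_val]
    have hr : Set.range ((↑) : B → F) = (B : Set F) := Subtype.range_coe
    have himg : (B.val : B → F) '' G = Set.range x' ∪ Set.range y := by
      rw [Subalgebra.coe_val, hG, Set.image_preimage_eq_inter_range, hr,
        Set.inter_eq_left.mpr]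
      exact Algebra.subset_adjoin
    rw [himg]
  haveI : Algebra.IsAlgebraic (Algebra.adjoin K₀ G) B :=
    ⟨fun b => isAlgebraic_algebraMap
      (⟨b, by rw [hGtop]; exact Algebra.mem_top⟩ : Algebra.adjoin K₀ G)⟩
  obtain ⟨u, -, huG, hu⟩ := exists_isTranscendenceBasis_between (R := K₀) (A := B) ∅ G
    (Set.empty_subset _)
    ((algebraicIndependent_empty_iff K₀ B).mpr (algebraMap K₀ B).injective)
  have hcard : #u = Algebra.trdeg K₀ B := hu.cardinalMk_eq_trdeg
  -- (4) no basis element lies over `x' '' J` (those are constants)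
  have hux : ∀ a ∈ u, (a : F) ∉ x' '' (J : Set (Fin n)) := by
    rintro a ha ⟨i, hi, hia⟩
    have htr : Transcendental K₀ ((fun b : u => (b : B)) ⟨a, ha⟩) := hu.1.transcendental ⟨a, ha⟩
    apply htr
    have heq : (a : B) = algebraMap K₀ B ⟨x' i, fun j => hJ i (by exact_mod_cast hi) j⟩ := by
      apply Subtype.ext
      rw [← hia]
      rfl
    show IsAlgebraic K₀ (a : B)
    rw [heq]
    exact isAlgebraic_algebraMap _
  -- the `y`-part of the basis
  set uy : Set B := {a | a ∈ u ∧ (a : F) ∈ Set.range y} with huy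
  have husub : u ⊆ ((↑) : B → F) ⁻¹' (x' '' ((Jᶜ : Finset (Fin n)) : Set (Fin n))) ∪ uy := by
    intro a ha
    rcases huG ha with ⟨i, hi⟩ | hy'
    · left
      refine ⟨i, ?_, hi⟩
      rw [Finset.coe_compl, Set.mem_compl_iff, Finset.mem_coe]
      intro hiJ
      exact hux a ha ⟨i, by exact_mod_cast hiJ, hi⟩
    · right
      exact ⟨ha, hy'⟩
  -- (5) `#uy ≤ d`: it is `ℂ`-algebraically independent inside `ℂ[y]`
  have huy_ind : AlgebraicIndependent K₀ ((↑) : uy → B) :=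
    hu.1.mono (fun a ha => ha.1)
  have huy_indF : AlgebraicIndependent K₀ (B.val ∘ ((↑) : uy → B)) :=
    huy_ind.map' (f := B.val) Subtype.val_injective
  have huy_indC : AlgebraicIndependent ℂ (B.val ∘ ((↑) : uy → B)) :=
    huy_indF.restrictScalars (algebraMap ℂ K₀).injective
  set φ := (aeval y : MvPolynomial (Fin n) ℂ →ₐ[ℂ] F) with hφ
  have hyφ : ∀ a : uy, ((a : B) : F) ∈ φ.range := by
    rintro ⟨a, -, ⟨i, hi⟩⟩
    refine ⟨X i, ?_⟩
    show aeval y (X i) = (a : F)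
    rw [aeval_X, hi]
  set g : uy → φ.range := fun a => ⟨((a : B) : F), hyφ a⟩ with hg
  have hg_ind : AlgebraicIndependent ℂ g := by
    apply AlgebraicIndependent.of_comp φ.range.val
    exact huy_indC
  have huy_le : #uy ≤ (d : Cardinal) :=
    hg_ind.cardinalMk_le_trdeg.trans (trdeg_range_aeval_le y I hI hd)
  -- (6) counting
  have hx'card : #(((↑) : B → F) ⁻¹' (x' '' ((Jᶜ : Finset (Fin n)) : Set (Fin n)))) ≤
      ((n - J.card : ℕ) : Cardinal) := by
    refine (mk_preimage_of_injective _ _ Subtype.val_injective).trans (mk_image_le.trans ?_)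
    have h2 : #(((Jᶜ : Finset (Fin n)) : Set (Fin n))) = ((Jᶜ : Finset (Fin n)).card : Cardinal) :=
      mk_coe_finset (s := Jᶜ)
    rw [h2, Finset.card_compl, Fintype.card_fin]
  have hB_le : Algebra.trdeg K₀ B ≤ ((n - J.card : ℕ) : Cardinal) + (d : Cardinal) := by
    rw [← hcard]
    exact (mk_le_mk_of_subset husub).trans ((mk_union_le _ _).trans (add_le_add hx'card huy_le))
  have hA_eq : Algebra.trdeg K₀ A = Algebra.trdeg K₀ B := (Subalgebra.equivOfEq A B hAB).trdeg_eq
  have hfinal : ((n + M.rank : ℕ) : Cardinal.{0}) ≤ ((n - J.card + d : ℕ) : Cardinal.{0}) := by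
    have := hAS.trans (hA_eq.le.trans hB_le)
    exact_mod_cast this
  have hnat : n + M.rank ≤ n - J.card + d := by exact_mod_cast hfinal
  have hJn : J.card ≤ n := by
    simpa only [Fintype.card_fin] using J.card_le_univ
  omega

end Literature.NumberTheory.Transcendental.WeakCIT
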